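import Summits.QuantumFields.YangMills.Theorems.UnitScaleTiltFluctuationComparisonRegPrGlobalSlackCanonicalPolymersTermSize
import HarnessLib

/-!
# `UnitScaleTiltFluctuationComparisonRegPrGlobalSlackCanonicalPolymersTermSizeC` — THE SIZE ROW `TermSizeTrivT` FOR THE CANONICAL POLYMERISATION WITHOUT THE
# `L ≤ M₁` LETTER (crux `FluctuationComparisonRegPrIntL`, stmt-QuantumFields-20520 — formerly 19935 —, STUB 3⁗ `stub_globalTwoRunSlackFam`; width-lever lane A,
# producer row 5; OWNER ym3-torus-plan g22 RULING №5 §C ask W-slack-1)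

Seat ym-ust-19935-slack g2 (prover).  g0's `termSizeTrivT_canon` (p537347) used `L ≤ M₁` at ONE point: to show that the canonical tree length of a BLOCK domain
vanishes (`canonTreeLen_blockSet`) — `canonTreeLen p K i Y` is the infimum of `tsys.dj` over the step-`(i−1)` domains whose point set is `Y`, and with `L ≤ M₁` a
`domSet` that is a level-`i` block is a single cube.  Without the letter a cube-shaped union of `(L/M₁)³` big blocks may be a block (when `M₁ ∣ L`); but counting
fine sites gives `#X.1 ≤ L³` for any such domain, and LQB's printed upper half of (2.30), `TreeLengthTorus.torusTreeLen_le_card_sub_one` (`d(X) ≤ #X − 1`), bounds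
its tree length by `L³`.  So the OLD-term size bound of (44) survives with the constant inflated by `e^{κ₁L³}` — absorbed, like every other `L`-dependence, by 3⁗'s `∃ C`.

* §1 `card_mul_cube_le_card_domSet` (`#X.1·(L^k)³ ≤ #domSet X`, no letter — each cube of `X` carries a whole big block of `min(M₁,S_k)³ ≥ 1` level-`k` sites),
  `card_le_of_domSet_eq_blockSet` (`#X.1 ≤ L³`), `dj_le_of_domSet_eq_blockSet` (`dj X ≤ L³`), `canonTreeLen_blockSet_le` (`canonTreeLen (blockSet) ≤ L³`);
* §2 **`termSizeTrivT_canon'`** — `TermSizeTrivT (dataOfV3 p (canonPolymer p)) (canonPT p) 𝔠.b₀ 𝔠.p₀ (max (newConst 𝔠) (oldConst 𝔠·L⁴·e^{κ₁L³})) κ₁` for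
  `0 < κ₁ ≤ 𝔠.κ` and the two coupling windows of `…Sizes`, NO condition on `M₁` (g0's proof with the block step replaced by the bound of §1).
Bookkeeping; nothing of [Balaban1985UV3] is asserted.

References: T. Bałaban, CMP 102 (1985) 255–275 [Balaban1985UV3] ((24)–(25) p.262, (43)–(46) pp.266–267, (59) p.270); CMP 116 (1988) 1–22 [Balaban1988RG2Cluster] ((2.30) p.18).
-/

set_option autoImplicit false

noncomputable section

namespace Summit.QuantumFields.YangMills.Theorems.GlobalSlackCanonicalPolymers

open scoped BigOperators
open Finset
open Literature.MathematicalPhysics.QuantumFieldTheory.Balaban1983to89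
open Literature.MathematicalPhysics.QuantumFieldTheory.Balaban1983to89.T3ContinuumYM3Torus
open Literature.MathematicalPhysics.QuantumFieldTheory.Balaban1983to89.T3UnitScaleTilt (θBal)
open Literature.MathematicalPhysics.QuantumFieldTheory.Balaban1983to89.T3LevelShift (fieldShift)
open Literature.MathematicalPhysics.QuantumFieldTheory.Balaban1983to89.T3AlphaInputsAC
open Literature.MathematicalPhysics.QuantumFieldTheory.Balaban1983to89.T3AlphaInputsACTwoRunLevel
open Literature.MathematicalPhysics.QuantumFieldTheory.Balaban1983to89.TreeLengthTorus (tsys TPt torusTreeLen_le_card_sub_one)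
open Literature.MathematicalPhysics.QuantumFieldTheory.Balaban1985CMP102
open Literature.MathematicalPhysics.QuantumFieldTheory.Balaban1985CMP102.Setting
open Summit.QuantumFields.Balaban3D.Carriers
open Summit.QuantumFields.Balaban3D.Proofs.Primitives
open Summit.QuantumFields.YangMills.Theorems

variable {F : T3Family} {𝔠 : AlphaConsts F.L (suGroupModel 2).N} {γ : ℝ} {hγ : 0 < γ} {hγ1 : γ ≤ (min 𝔠.gamma0 1) ^ 2}

/-! ## §1 A block domain has at most `L³` cubes, hence canonical tree length `≤ L³` -/

/-- **EVERY CUBE OF A DOMAIN CARRIES AT LEAST ONE WHOLE BLOCK OF FINE SITES**: `#X.1 · (L^k)³ ≤ #domSet M₁ K k X` for `k ≤ m + K`, NO condition on `M₁`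
(no wrap-around: the cubes' big blocks are disjoint with `M₁³ ≥ 1` level-`k` sites each; small torus: one cube, and `domSet` is everything).
[cite: Balaban1985UV3, (24) p.262, (59) p.270] -/
theorem card_mul_cube_le_card_domSet (K k : ℕ) (hk : k ≤ F.m + K) (X : (tsys 3 (nblkOf (SK F 𝔠 γ hγ hγ1 K) 𝔠.lane.carrier k)).Dom) :
    (X.1.card : ℝ) * ((F.L : ℝ) ^ k) ^ 3 ≤ ∑ x : Site (F.P K) 0, (domSet (F := F) 𝔠.lane.carrier.M₁ K k X).indicator (fun _ => (1 : ℝ)) x := by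
  classical
  have hM0 : 0 < 𝔠.M₁ := 𝔠.M₁_pos
  rw [sum_indicator_eq_card]
  by_cases hcase : 𝔠.M₁ ≤ (F.P K).sitesPerDir k
  · -- disjoint big blocks, one per cube of `X`
    have hN : nblkOf (SK F 𝔠 γ hγ hγ1 K) 𝔠.lane.carrier k = (F.P K).sitesPerDir k / 𝔠.M₁ := by
      rw [nblkOf_SK]; exact max_eq_right (Nat.div_pos hcase hM0)
    have ht : ∀ b : TPt 3 (nblkOf (SK F 𝔠 γ hγ hγ1 K) 𝔠.lane.carrier k), ∀ μ, (b μ).val * 𝔠.M₁ + 𝔠.M₁ ≤ (F.P K).sitesPerDir k := fun b μ => by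
      have h1 : (b μ).val < (F.P K).sitesPerDir k / 𝔠.M₁ := lt_of_lt_of_eq (ZMod.val_lt (b μ)) hN
      calc (b μ).val * 𝔠.M₁ + 𝔠.M₁ = ((b μ).val + 1) * 𝔠.M₁ := by ring
        _ ≤ ((F.P K).sitesPerDir k / 𝔠.M₁) * 𝔠.M₁ := Nat.mul_le_mul_right _ h1
        _ ≤ (F.P K).sitesPerDir k := Nat.div_mul_le_self _ _
    let Zb : TPt 3 (nblkOf (SK F 𝔠 γ hγ hγ1 K) 𝔠.lane.carrier k) → Finset (Site (F.P K) k) :=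
      fun b => univ.image (offSite F K k 𝔠.M₁ (fun μ => (b μ).val) (w := 𝔠.M₁))
    have hZcard : ∀ b, (Zb b).card = 𝔠.M₁ ^ 3 := fun b => by
      show (univ.image _).card = _
      rw [card_image_of_injective _ (offSite_injective K k 𝔠.M₁ _ (ht b)), card_univ, Fintype.card_fun, Fintype.card_fin, Fintype.card_fin]
    have hlab : ∀ b, ∀ z ∈ Zb b, ∀ μ, (z μ).val / 𝔠.M₁ = (b μ).val := by
      intro b z hz μ
      obtain ⟨r, -, rfl⟩ := mem_image.mp hz
      exact bigLabel_offSite K k 𝔠.M₁ hM0 _ r μ (ht b μ)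
    have hdisj : (X.1 : Set (TPt 3 _)).PairwiseDisjoint Zb := by
      intro b _ b' _ hbb
      rw [Function.onFun, Finset.disjoint_left]
      intro z hz hz'
      exact hbb (funext fun μ => ZMod.val_injective _ ((hlab b z hz μ).symm.trans (hlab b' z hz' μ)))
    set Z := X.1.biUnion Zb with hZ
    have hZtot : Z.card = X.1.card * 𝔠.M₁ ^ 3 := by
      rw [hZ, card_biUnion hdisj, Finset.sum_const_nat fun b _ => hZcard b]
    have hsub : (univ.filter fun x : Site (F.P K) 0 => coarsen k x ∈ Z) ⊆
        univ.filter fun x => x ∈ domSet (F := F) 𝔠.lane.carrier.M₁ K k X := by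
      intro x hx
      rw [mem_filter] at hx ⊢
      obtain ⟨b, hb, hz⟩ := mem_biUnion.mp hx.2
      refine ⟨hx.1, ?_⟩
      simp only [domSet, Set.mem_setOf_eq]
      exact ⟨b, hb, funext fun μ => hlab b _ hz μ⟩
    have hpow : X.1.card * (F.L ^ k) ^ 3 ≤ X.1.card * (𝔠.M₁ ^ 3 * ((F.P K).L ^ k) ^ 3) := by
      refine Nat.mul_le_mul_left _ ?_
      calc (F.L ^ k) ^ 3 = 1 * ((F.P K).L ^ k) ^ 3 := by rw [one_mul]; rfl
        _ ≤ 𝔠.M₁ ^ 3 * ((F.P K).L ^ k) ^ 3 := Nat.mul_le_mul_right _ (Nat.one_le_pow _ _ hM0)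
    calc (X.1.card : ℝ) * ((F.L : ℝ) ^ k) ^ 3 = ((X.1.card * (F.L ^ k) ^ 3 : ℕ) : ℝ) := by push_cast; ring
      _ ≤ ((X.1.card * (𝔠.M₁ ^ 3 * ((F.P K).L ^ k) ^ 3) : ℕ) : ℝ) := by exact_mod_cast hpow
      _ = ((univ.filter fun x : Site (F.P K) 0 => coarsen k x ∈ Z).card : ℝ) := by
          rw [card_filter_coarsen_mem K k hk Z, hZtot]; push_cast; ring
      _ ≤ _ := by exact_mod_cast card_le_card hsub
  · -- small torus: one cube, the domain is the whole fine torus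
    rw [not_le] at hcase
    have hN : nblkOf (SK F 𝔠 γ hγ hγ1 K) 𝔠.lane.carrier k = 1 := by rw [nblkOf_SK, Nat.div_eq_of_lt hcase]; rfl
    have hc1 : X.1.card ≤ 1 := by
      calc X.1.card ≤ (univ : Finset (TPt 3 (nblkOf (SK F 𝔠 γ hγ hγ1 K) 𝔠.lane.carrier k))).card := card_le_card (subset_univ _)
        _ = 1 := by rw [card_univ, TreeLengthTorus.card_tpt, hN]; norm_num
    obtain ⟨b, hb⟩ := X.2.1
    have hall : (univ.filter fun x : Site (F.P K) 0 => x ∈ domSet (F := F) 𝔠.lane.carrier.M₁ K k X) = univ := by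
      refine Finset.filter_true_of_mem fun x _ => ?_
      simp only [domSet, Set.mem_setOf_eq]
      refine ⟨b, hb, funext fun μ => ?_⟩
      have h1 : ((coarsen k x) μ).val < 𝔠.M₁ := lt_trans (ZMod.val_lt _) hcase
      have h2 : (b μ).val = 0 := by have := lt_of_lt_of_eq (ZMod.val_lt (b μ)) hN; omega
      show ((coarsen k x) μ).val / 𝔠.M₁ = (b μ).val
      rw [h2]
      exact Nat.div_eq_of_lt h1
    rw [hall, card_univ, LogComparisonPolymerBudget.card_site_zero]
    have hL1 : (1 : ℝ) ≤ F.L := by exact_mod_cast F.hL.2.le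
    have hc1' : (X.1.card : ℝ) ≤ 1 := by exact_mod_cast hc1
    have hx0 : (0 : ℝ) ≤ ((F.L : ℝ) ^ k) ^ 3 := by positivity
    have hx1 : (0 : ℝ) ≤ (F.L : ℝ) ^ (3 * (F.m + K)) := by positivity
    calc (X.1.card : ℝ) * ((F.L : ℝ) ^ k) ^ 3 ≤ 1 * ((F.L : ℝ) ^ k) ^ 3 := mul_le_mul_of_nonneg_right hc1' hx0
      _ = (F.L : ℝ) ^ (3 * k) := by rw [one_mul, ← pow_mul, mul_comm]
      _ ≤ (F.L : ℝ) ^ (3 * (F.m + K)) := pow_le_pow_right₀ hL1 (by omega)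
      _ ≤ 8 * (F.L : ℝ) ^ (3 * (F.m + K)) := by linarith

/-- **A DOMAIN WHOSE POINT SET IS A BLOCK HAS AT MOST `L³` CUBES** (`k + 1 ≤ m + K`, no condition on `M₁`): `#X.1·(L^k)³ ≤ #blockSet = (L^{k+1})³`.
[cite: Balaban1985UV3, (24) p.262] -/
theorem card_le_of_domSet_eq_blockSet (K k : ℕ) (hk : k + 1 ≤ F.m + K)
    (X : (tsys 3 (nblkOf (SK F 𝔠 γ hγ hγ1 K) 𝔠.lane.carrier k)).Dom) (y : Site (F.P K) (k + 1))
    (h : domSet (F := F) 𝔠.lane.carrier.M₁ K k X = blockSet K (k + 1) y) : (X.1.card : ℝ) ≤ (F.L : ℝ) ^ 3 := by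
  classical
  have hcnt := card_mul_cube_le_card_domSet (γ := γ) (hγ := hγ) (hγ1 := hγ1) K k (by omega) X
  rw [h, sum_indicator_blockSet K (k + 1) hk y] at hcnt
  have hL1 : (1 : ℝ) ≤ F.L := by exact_mod_cast F.hL.2.le
  have hpos : (0 : ℝ) < ((F.L : ℝ) ^ k) ^ 3 := by positivity
  have he : (F.L : ℝ) ^ (3 * (k + 1)) = (F.L : ℝ) ^ 3 * ((F.L : ℝ) ^ k) ^ 3 := by
    rw [show 3 * (k + 1) = 3 + k * 3 by ring, pow_add, pow_mul]
  rw [he] at hcnt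
  exact le_of_mul_le_mul_right hcnt hpos

/-- **ITS TREE LENGTH IS AT MOST `L³`** — LQB's printed upper half of (2.30), `d(X) ≤ #X − 1`. [cite: Balaban1988RG2Cluster, (2.30) p.18] -/
theorem dj_le_of_domSet_eq_blockSet (K k : ℕ) (hk : k + 1 ≤ F.m + K)
    (X : (tsys 3 (nblkOf (SK F 𝔠 γ hγ hγ1 K) 𝔠.lane.carrier k)).Dom) (y : Site (F.P K) (k + 1))
    (h : domSet (F := F) 𝔠.lane.carrier.M₁ K k X = blockSet K (k + 1) y) :
    (tsys 3 (nblkOf (SK F 𝔠 γ hγ hγ1 K) 𝔠.lane.carrier k)).dj X ≤ (F.L : ℝ) ^ 3 := by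
  have hc := card_le_of_domSet_eq_blockSet (γ := γ) (hγ := hγ) (hγ1 := hγ1) K k hk X y h
  have ht := torusTreeLen_le_card_sub_one X.2.1 X.2.2
  show TreeLengthTorus.torusTreeLen X.1 ≤ (F.L : ℝ) ^ 3
  linarith

/-- **THE CANONICAL TREE LENGTH OF A BLOCK DOMAIN IS AT MOST `L³`** (`1 ≤ i ≤ m + K`, no condition on `M₁`; with `L ≤ M₁` it is `0`, g0's `canonTreeLen_blockSet`).
[cite: Balaban1985UV3, (24)-(25) p.262] -/
theorem canonTreeLen_blockSet_le (p : ∀ K, AlphaInputsT3AC.PkgAtV3 F 𝔠 γ hγ hγ1 K) (K i : ℕ) (hi1 : 1 ≤ i) (hi : i ≤ F.m + K)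
    (y : Site (F.P K) i) : canonTreeLen p K i (blockSet K i y) ≤ (F.L : ℝ) ^ 3 := by
  obtain ⟨k, rfl⟩ : ∃ k, i = k + 1 := ⟨i - 1, by omega⟩
  unfold canonTreeLen
  set S := (fun X => (tsys 3 ((p K).𝔖 (k + 1 - 1)).Nblk).dj X) ''
      {X : (tsys 3 ((p K).𝔖 (k + 1 - 1)).Nblk).Dom | domSet (F := F) 𝔠.lane.carrier.M₁ K (k + 1 - 1) X = blockSet K (k + 1) y} with hS
  have hL3 : (0 : ℝ) ≤ (F.L : ℝ) ^ 3 := by positivity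
  rcases S.eq_empty_or_nonempty with hE | ⟨t, X, hX, rfl⟩
  · rw [hE, Real.sInf_empty]; exact hL3
  · have hbdd : BddBelow S := ⟨0, by rintro s ⟨X', -, rfl⟩; exact (tsys 3 _).dj_nonneg X'⟩
    refine (csInf_le hbdd ⟨X, hX, rfl⟩).trans ?_
    exact dj_le_of_domSet_eq_blockSet (γ := γ) (hγ := hγ) (hγ1 := hγ1) K k hi X y hX

/-! ## §2 The size row without the letter -/

/-- **`TermSizeTrivT` FOR THE CANONICAL POLYMERISATION OF EVERY v3 FAMILY, NO CONDITION ON `M₁`**: for `0 < κ₁ ≤ 𝔠.κ` and the two coupling windows of `…Sizes`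
(`cB·r(g_k)g_kp(g_k) ≤ ρ/4` and `8L²B₃Z′·g_kp(g_k) ≤ ½` at every step `k < K` of every run), the canonical term function obeys print's (44) at the trivial history
with constant `max (newConst 𝔠) (oldConst 𝔠·L⁴·e^{κ₁L³})` — g0's `termSizeTrivT_canon` (p537347) with the block tree length bounded by `L³` instead of `= 0`.
The producer's FIFTH row, discharged for every constants record. [cite: Balaban1985UV3, (44)-(45) p.267, (34) p.264] -/
theorem termSizeTrivT_canon' (p : ∀ K, AlphaInputsT3AC.PkgAtV3 F 𝔠 γ hγ hγ1 K) {κ₁ : ℝ} (hκ₁ : 0 < κ₁) (hκle : κ₁ ≤ 𝔠.κ)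
    (hw1 : ∀ K k, k + 1 ≤ K → 𝔠.cB * (B10.rFun 𝔠.r₀ ((SK F 𝔠 γ hγ hγ1 K).gk k) * (SK F 𝔠 γ hγ hγ1 K).gk k *
        B10.pFun 𝔠.b₀ 𝔠.p₀ ((SK F 𝔠 γ hγ hγ1 K).gk k)) ≤ 𝔠.ρ / 4)
    (hw2 : ∀ K k, k + 1 ≤ K → 8 * (F.L : ℝ) ^ 2 * 𝔠.B₃ * 𝔠.Zfull *
        ((SK F 𝔠 γ hγ hγ1 K).gk k * B10.pFun 𝔠.b₀ 𝔠.p₀ ((SK F 𝔠 γ hγ hγ1 K).gk k)) ≤ 1 / 2) :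
    TermSizeTrivT (AlphaInputsT3AC.dataOfV3 p (canonPolymer p)) (canonPT p) 𝔠.b₀ 𝔠.p₀
      (max (newConst 𝔠) (oldConst 𝔠 * (F.L : ℝ) ^ 4 * Real.exp (κ₁ * (F.L : ℝ) ^ 3))) κ₁ := by
  classical
  refine ⟨hκ₁, fun K n hn V hV i hi1 hi2 Y hY => ?_⟩
  change Y ∈ canonLoc p K (K - n) (Hist.triv (F.P K) (K - n)) i at hY
  change |canonPT p K (K - n) i Y _| ≤ max (newConst 𝔠) (oldConst 𝔠 * (F.L : ℝ) ^ 4 * Real.exp (κ₁ * (F.L : ℝ) ^ 3)) *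
    Real.exp (-κ₁ * canonTreeLen p K i Y) * θBal F.L γ 𝔠.b₀ 𝔠.p₀ (n + 1) ^ 2 * (((F.L : ℝ) ^ (K - n - i))⁻¹) ^ 4
  -- name the lattice level `K − n = k + 1`
  suffices hW : ∀ W : GaugeField (F.P K) (K - n) (Matrix.specialUnitaryGroup (Fin 2) ℂ), |canonPT p K (K - n) i Y W| ≤
      max (newConst 𝔠) (oldConst 𝔠 * (F.L : ℝ) ^ 4 * Real.exp (κ₁ * (F.L : ℝ) ^ 3)) * Real.exp (-κ₁ * canonTreeLen p K i Y) *
        θBal F.L γ 𝔠.b₀ 𝔠.p₀ (n + 1) ^ 2 * (((F.L : ℝ) ^ (K - n - i))⁻¹) ^ 4 from hW _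
  obtain ⟨k, hk⟩ : ∃ k, K - n = k + 1 := ⟨K - n - 1, by omega⟩
  rw [hk] at hY
  rw [hk]
  intro W
  have hkK : k + 1 ≤ K := by omega
  have hKk : K - k = n + 1 := by omega
  have hkm : k ≤ F.m + K := by have := F.hm; omega
  have hL1 : (1 : ℝ) ≤ F.L := by exact_mod_cast F.hL.2.le
  have hL0 : (0 : ℝ) < F.L := by linarith
  have hθ2 : 0 ≤ θBal F.L γ 𝔠.b₀ 𝔠.p₀ (n + 1) ^ 2 := sq_nonneg _
  have hmax0 : 0 ≤ max (newConst 𝔠) (oldConst 𝔠 * (F.L : ℝ) ^ 4 * Real.exp (κ₁ * (F.L : ℝ) ^ 3)) :=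
    le_max_of_le_left (newConst_nonneg 𝔠)
  by_cases hik : i = k + 1
  · -- NEW term of a retained domain
    subst hik
    simp only [canonLoc, if_pos hkK, ite_true, mem_image] at hY
    obtain ⟨X, hX, rfl⟩ := hY
    rw [canonPT_new_eq p K k hkK X hX W, canonTreeLen_domSet p K k hkm X]
    have hb := abs_newTerm_le_theta p K k hkK (hw1 K k hkK) X W
    rw [hKk] at hb
    refine hb.trans ?_
    have hx : (((F.L : ℝ) ^ (k + 1 - (k + 1)))⁻¹) ^ 4 = 1 := by simp
    rw [hx, mul_one]
    have hexp : Real.exp (-(𝔠.κ * (tsys 3 (nblkOf (SK F 𝔠 γ hγ hγ1 K) 𝔠.lane.carrier k)).dj X)) ≤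
        Real.exp (-κ₁ * (tsys 3 (nblkOf (SK F 𝔠 γ hγ hγ1 K) 𝔠.lane.carrier k)).dj X) := by
      rw [Real.exp_le_exp]
      have := (tsys 3 (nblkOf (SK F 𝔠 γ hγ hγ1 K) 𝔠.lane.carrier k)).dj_nonneg X
      nlinarith
    calc newConst 𝔠 * θBal F.L γ 𝔠.b₀ 𝔠.p₀ (n + 1) ^ 2 * Real.exp (-(𝔠.κ * (tsys 3 _).dj X))
        ≤ max (newConst 𝔠) (oldConst 𝔠 * (F.L : ℝ) ^ 4 * Real.exp (κ₁ * (F.L : ℝ) ^ 3)) * θBal F.L γ 𝔠.b₀ 𝔠.p₀ (n + 1) ^ 2 *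
            Real.exp (-κ₁ * (tsys 3 _).dj X) :=
          mul_le_mul (mul_le_mul_of_nonneg_right (le_max_left _ _) hθ2) hexp (Real.exp_pos _).le (mul_nonneg hmax0 hθ2)
      _ = _ := by ring
  · by_cases hi : i ∈ Finset.Icc 1 k
    · -- OLD term of a block: tree length `≤ L³`, paid by `e^{κ₁L³}` in the constant
      simp only [canonLoc, if_pos hkK, if_neg hik, if_pos hi, mem_image] at hY
      obtain ⟨y, hy, rfl⟩ := hY
      have him : i ≤ F.m + K := by have := (Finset.mem_Icc.mp hi).2; omega
      rw [canonPT_old_eq p K k hkK i hi y hy W]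
      have htl := canonTreeLen_blockSet_le p K i hi1 him y
      have hb := abs_oldTerm_le p K k hkK i hi (hw2 K k hkK) y W
      have heps : (SK F 𝔠 γ hγ hγ1 K).gk k * B10.pFun 𝔠.b₀ 𝔠.p₀ ((SK F 𝔠 γ hγ hγ1 K).gk k) = θBal F.L γ 𝔠.b₀ 𝔠.p₀ (K - k) :=
        (p K).eps1_eq k (by omega)
      rw [heps, hKk] at hb
      refine hb.trans ?_
      -- `ℓ_i⁴ = L⁴ · (L^{k+1−i})⁻⁴`
      have hik' : i ≤ k := (Finset.mem_Icc.mp hi).2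
      have hell : ell (F.P K) k i ^ 4 = (F.L : ℝ) ^ 4 * (((F.L : ℝ) ^ (k + 1 - i))⁻¹) ^ 4 := by
        have e1 : ell (F.P K) k i = ((F.L : ℝ)⁻¹) ^ (k - i) := rfl
        have hL4 : ((F.L : ℝ) * (F.L : ℝ)⁻¹) ^ 4 = 1 := by rw [mul_inv_cancel₀ hL0.ne', one_pow]
        rw [e1, show k + 1 - i = (k - i) + 1 by omega, pow_succ (F.L : ℝ) (k - i), mul_inv, mul_pow, ← inv_pow (F.L : ℝ) (k - i)]
        calc ((F.L : ℝ)⁻¹ ^ (k - i)) ^ 4 = ((F.L : ℝ)⁻¹ ^ (k - i)) ^ 4 * ((F.L : ℝ) * (F.L : ℝ)⁻¹) ^ 4 := by rw [hL4, mul_one]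
          _ = _ := by ring
      rw [hell]
      have hE : 1 ≤ Real.exp (κ₁ * (F.L : ℝ) ^ 3) * Real.exp (-κ₁ * canonTreeLen p K i (blockSet K i y)) := by
        rw [← Real.exp_add]
        refine Real.one_le_exp ?_
        nlinarith
      have hO : 0 ≤ oldConst 𝔠 * (F.L : ℝ) ^ 4 := mul_nonneg (oldConst_nonneg 𝔠) (by positivity)
      have hx4 : 0 ≤ (((F.L : ℝ) ^ (k + 1 - i))⁻¹) ^ 4 := by positivity
      calc oldConst 𝔠 * θBal F.L γ 𝔠.b₀ 𝔠.p₀ (n + 1) ^ 2 * ((F.L : ℝ) ^ 4 * (((F.L : ℝ) ^ (k + 1 - i))⁻¹) ^ 4)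
          = (oldConst 𝔠 * (F.L : ℝ) ^ 4) * 1 * (θBal F.L γ 𝔠.b₀ 𝔠.p₀ (n + 1) ^ 2 * (((F.L : ℝ) ^ (k + 1 - i))⁻¹) ^ 4) := by ring
        _ ≤ (oldConst 𝔠 * (F.L : ℝ) ^ 4) *
              (Real.exp (κ₁ * (F.L : ℝ) ^ 3) * Real.exp (-κ₁ * canonTreeLen p K i (blockSet K i y))) *
              (θBal F.L γ 𝔠.b₀ 𝔠.p₀ (n + 1) ^ 2 * (((F.L : ℝ) ^ (k + 1 - i))⁻¹) ^ 4) :=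
            mul_le_mul_of_nonneg_right (mul_le_mul_of_nonneg_left hE hO) (mul_nonneg hθ2 hx4)
        _ = (oldConst 𝔠 * (F.L : ℝ) ^ 4 * Real.exp (κ₁ * (F.L : ℝ) ^ 3)) * Real.exp (-κ₁ * canonTreeLen p K i (blockSet K i y)) *
              θBal F.L γ 𝔠.b₀ 𝔠.p₀ (n + 1) ^ 2 * (((F.L : ℝ) ^ (k + 1 - i))⁻¹) ^ 4 := by ring
        _ ≤ _ := mul_le_mul_of_nonneg_right (mul_le_mul_of_nonneg_right
              (mul_le_mul_of_nonneg_right (le_max_right _ _) (Real.exp_pos _).le) hθ2) hx4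
    · simp only [canonLoc, if_pos hkK, if_neg hik, if_neg hi] at hY
      simp at hY

end Summit.QuantumFields.YangMills.Theorems.GlobalSlackCanonicalPolymers

end
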